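import Literature.AnabelianGeometry.AbsoluteAnabelian.AbsTopI.ChainTransportThm
import Literature.AnabelianGeometry.AbsoluteAnabelian.AbsTopI.SemiAbsoluteChainsHyp
import HarnessLib

/-!
# [AbsTopI] Def 4.2 (iii)/(iv), Thm 4.7 (i)/(iii): `Chain(Π)` is essentially small — the FACT-LIST
# schema rows F-0200 / F-0202 are JOINTLY MODEL-WITNESSED at every parameter

S. Mochizuki, *Topics in Absolute Anabelian Geometry I: Generalities*, J. Math. Sci. Univ. Tokyo 19
(2012) [MochizukiAbsTopI2012], Def 4.2 (iii)–(iv) pp. 49–50, Rmk 4.2.1 p. 51, Thm 4.7 (i)/(iii) p. 57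
(manuscript pagination, lit key `paper:url-11ac98ba15fc`).

PROOF-ONLY companion of `AbsTopI/SemiAbsoluteChains.lean` (abc-iut cell, block F, seat abc-iut-f-058,
tranche 58; FACT-LIST rows **F-0200** `AbsTopI.SchemeChains.Thm_4_7_i`, **F-0202**
`AbsTopI.SchemeChains.Thm_4_7_iii`).  No `def`, no `structure`, no `instance`; nothing of the trunk
file is restated or edited.  The companion `SemiAbsoluteChainsSchema.lean` (same seat) refuted the
universal closures of both rows over the free scheme-chain interface and model-witnessed (iii) alone,
recording honestly that (i) — essential surjectivity of `Chain(X̃/X) → Chain(Π)` onto a category whose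
objects form a `Type (u+1)` — "is not witnessed by any cheap `Obj : Type u`".  This file supplies the
non-cheap witness:

* `ChainGroup.exists_injective_prod_nat` — every term `Πⱼ` of a `Π`-chain injects (as a set) into
  `Π × ℕ`: by Def 4.2 (iii) it carries an OPEN rigidifying homomorphism `ρⱼ : Π̃ⱼ → Πⱼ` from an open
  subgroup `Π̃ⱼ ⊆ Π`; an open subgroup of the compact group `Πⱼ` has finite index
  (`Subgroup.quotient_finite_of_isOpen`), so `Πⱼ ≃ (Πⱼ ⧸ ρⱼ(Π̃ⱼ)) × ρⱼ(Π̃ⱼ) ↪ ℕ × Π`.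
* `ChainGroup.exists_code` — hence the terms are classified UP TO ISOMORPHISM OVER `id_Π` (Def 4.2
  (iv): isomorphisms compatible with the rigidifying homomorphisms and the projections to `G`) by a
  `Type u`-valued code (image in `Π × ℕ` of the group law, the topology, `Πⱼ → G`, `Π̃ⱼ`, `ρⱼ`).
* `PiChain.exists_small_cover` — **`Chain(Π)` is essentially `u`-small**: there are a `Type u` index
  `ι` and a family `g : ι → Chain(Π)` meeting every isomorphism class.
* `SchemeChains.exists_thm_4_7_i_and_iii` — at EVERY admissible parameter `(E, C, hP, hΔ, hne)` there
  is a scheme-chain datum `S` with `S.Thm_4_7_i ∧ S.Thm_4_7_iii`: the small skeleton of `Chain(Π)`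
  itself, with isomorphisms / terminal (iso)morphisms pulled back along `g`.  HONEST LABEL: the scheme
  side is MODELLED by the group-theoretic side (a consistency witness for the joint typing of Thm 4.7
  (i) and (iii); the genuine functor `Chain(X̃/X) → Chain(Π)` of a hyperbolic orbicurve is not in the
  tree, FOUNDATIONS row 12).  FACT-LIST reading: F-0200 and F-0202 «universal closure REFUTED
  (`SemiAbsoluteChainsSchema`); instance forms JOINTLY MODEL-WITNESSED at every parameter (this file)».

Refuted is never a fact; a model witness is consistency evidence, not an endorsement; typed ≠ proved
for anything not in this file; nothing here bears on [IUTchIII] Cor 3.12 or takes a side on any author.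

## References
* [MochizukiAbsTopI2012] S. Mochizuki, *Topics in absolute anabelian geometry I: generalities*,
  J. Math. Sci. Univ. Tokyo 19 (2012) 139–242 — Def 4.2 (iii)(iv) pp. 49–50, Rmk 4.2.1 p. 51,
  Thm 4.7 p. 57.
-/

noncomputable section

open CategoryTheory Topology
open scoped Pointwise

universe u

namespace Literature.AnabelianGeometry.AbsoluteAnabelian.AbsTopI

open Literature.AlgebraicGeometry.Frobenioids (IsSlimGroup)
open FundamentalExtension

variable {E : FundamentalExtension.{u}}

/-! ### Every term of a `Π`-chain injects into `Π × ℕ` -/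

/-- **[AbsTopI] Def 4.2 (iii)** p. 49: a term `Πⱼ` of a `Π`-chain is "equipped with an open
rigidifying homomorphism `ρⱼ : Π̃ⱼ → Πⱼ` [from an open subgroup `Π̃ⱼ ⊆ Π`]"; since `Πⱼ` is compact, the
open subgroup `ρⱼ(Π̃ⱼ)` has finite index, so `Πⱼ ≃ (Πⱼ ⧸ ρⱼ(Π̃ⱼ)) × ρⱼ(Π̃ⱼ)` injects into `ℕ × Π`.
In particular `#Πⱼ ≤ #Π · ℵ₀` for every term of every chain.
[cite: MochizukiAbsTopI2012, Def 4.2 (iii) p.49] -/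
theorem ChainGroup.exists_injective_prod_nat (L : E.ChainGroup) :
    ∃ f : L.grp → E.arith × ℕ, Function.Injective f := by
  classical
  -- the image `H := ρⱼ(Π̃ⱼ)` of the rigidifying homomorphism: an open subgroup of the compact `Πⱼ`
  let H : Subgroup L.grp := L.rig.toMonoidHom.range
  have hH : IsOpen (H : Set L.grp) := by
    have hcoe : (H : Set L.grp) = Set.range L.rig := MonoidHom.coe_range L.rig.toMonoidHom
    rw [hcoe]
    exact L.isOpen_range_rig
  -- finite index
  haveI : Finite (L.grp ⧸ H) := Subgroup.quotient_finite_of_isOpen H hH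
  obtain ⟨ν, hν⟩ := Countable.exists_injective_nat (L.grp ⧸ H)
  -- a set-theoretic section of `ρⱼ : Π̃ⱼ ↠ H`
  have hsec : ∀ y : H, ∃ x : L.dom, L.rig x = (y : L.grp) := fun y => MonoidHom.mem_range.mp y.2
  choose s hs using hsec
  have hs_inj : Function.Injective s := by
    intro y₁ y₂ h
    apply Subtype.ext
    rw [← hs y₁, ← hs y₂, h]
  -- `Πⱼ ≃ (Πⱼ ⧸ H) × H`
  let e := Subgroup.groupEquivQuotientProdSubgroup (s := H)
  refine ⟨fun z => (((s (e z).2 : L.dom) : E.arith), ν (e z).1), ?_⟩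
  intro z₁ z₂ h
  simp only [Prod.mk.injEq] at h
  obtain ⟨h1, h2⟩ := h
  apply e.injective
  exact Prod.ext (hν h2) (hs_inj (Subtype.ext h1))

/-! ### A `Type u`-valued code classifying chain terms up to isomorphism over `id` -/

/-- Two chain terms whose elements are matched by injections into a common set `W` under which the
group laws, the topologies, the projections to `G`, the domains `Π̃ⱼ` and the rigidifying homomorphisms
correspond are ISOMORPHIC in the sense of [AbsTopI] Def 4.2 (iv) (over `φ = id`: "isomorphisms of
profinite groups `Πⱼ ≅ Ψⱼ` that are compatible with the rigidifying homomorphisms").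
[cite: MochizukiAbsTopI2012, Def 4.2 (iv) p.50] -/
theorem ChainGroup.nonempty_isoOver_refl_of_matched {L₁ L₂ : E.ChainGroup} {W : Type u}
    (ι₁ : L₁.grp → W) (ι₂ : L₂.grp → W) (h₁ : Function.Injective ι₁) (h₂ : Function.Injective ι₂)
    (hs : Set.range ι₁ = Set.range ι₂)
    (hm : ∀ (a b : L₁.grp) (a' b' : L₂.grp), ι₁ a = ι₂ a' → ι₁ b = ι₂ b' →
      ι₁ (a * b) = ι₂ (a' * b'))
    (hO : ∀ U : Set W, (∃ V : Set L₁.grp, IsOpen V ∧ U = ι₁ '' V) ↔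
      (∃ V : Set L₂.grp, IsOpen V ∧ U = ι₂ '' V))
    (hp : ∀ (a : L₁.grp) (a' : L₂.grp), ι₁ a = ι₂ a' → L₁.proj a = L₂.proj a')
    (hd : L₁.dom = L₂.dom)
    (hr : ∀ (x : E.arith) (hx₁ : x ∈ L₁.dom) (hx₂ : x ∈ L₂.dom),
      ι₁ (L₁.rig ⟨x, hx₁⟩) = ι₂ (L₂.rig ⟨x, hx₂⟩)) :
    Nonempty (ChainGroupIsoOver (Iso.refl E) L₁ L₂) := by
  classical
  -- the bijection `f : Π₁ⱼ → Π₂ⱼ` matching elements with the same image in `W`, and its inverse `g`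
  have hex : ∀ a : L₁.grp, ∃ a' : L₂.grp, ι₂ a' = ι₁ a := fun a => by
    have ha : ι₁ a ∈ Set.range ι₂ := hs ▸ Set.mem_range_self a
    exact ha
  have hex' : ∀ a' : L₂.grp, ∃ a : L₁.grp, ι₁ a = ι₂ a' := fun a' => by
    have ha : ι₂ a' ∈ Set.range ι₁ := hs.symm ▸ Set.mem_range_self a'
    exact ha
  choose f hf using hex
  choose g hg using hex'
  have hgf : ∀ a, g (f a) = a := fun a => h₁ (by rw [hg, hf])
  have hfg : ∀ a', f (g a') = a' := fun a' => h₂ (by rw [hf, hg])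
  -- continuity of `f` and `g` from the matching of the topologies
  have hfc : Continuous f := by
    rw [continuous_def]
    intro U hU
    obtain ⟨V, hV, hVU⟩ := (hO (ι₂ '' U)).mpr ⟨U, hU, rfl⟩
    have hpre : f ⁻¹' U = V := by
      ext a
      rw [Set.mem_preimage, ← h₂.mem_set_image, hf, hVU, h₁.mem_set_image]
    rw [hpre]
    exact hV
  have hgc : Continuous g := by
    rw [continuous_def]
    intro U hU
    obtain ⟨V, hV, hVU⟩ := (hO (ι₁ '' U)).mp ⟨U, hU, rfl⟩
    have hpre : g ⁻¹' U = V := by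
      ext a
      rw [Set.mem_preimage, ← h₁.mem_set_image, hg, hVU, h₂.mem_set_image]
    rw [hpre]
    exact hV
  let I : L₁.grp ≃ₜ* L₂.grp :=
    { toFun := f
      invFun := g
      left_inv := hgf
      right_inv := hfg
      map_mul' := fun a b => h₂ (by rw [hf]; exact hm a b (f a) (f b) (hf a).symm (hf b).symm)
      continuous_toFun := hfc
      continuous_invFun := hgc }
  refine ⟨{ iso := I
            proj_comm := fun a => ?_
            rig_comm := ⟨L₁.dom, L₁.isOpen_dom, le_rfl, ?_, ?_⟩ }⟩
  · -- compatibility with the projections to `G`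
    show L₂.proj (f a) = L₁.proj a
    exact (hp a (f a) (hf a).symm).symm
  · -- `id(Π̃₁ⱼ) = Π̃₁ⱼ = Π̃₂ⱼ`
    intro y hy
    obtain ⟨x, hx, rfl⟩ := hy
    show x ∈ L₂.dom
    rw [← hd]
    exact hx
  · -- compatibility with the rigidifying homomorphisms on `Π̃ⱼ`
    rintro ⟨x, hx⟩
    show f (L₁.rig ⟨x, hx⟩) = L₂.rig ⟨x, _⟩
    apply h₂
    rw [hf]
    exact hr x hx _

/-- Hence the chain terms over `Π_E` are classified up to isomorphism over `id` ([AbsTopI] Def 4.2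
(iv)) by a `Type u`-valued invariant: transporting each `Πⱼ` along an injection into `W := Π × ℕ`
(`ChainGroup.exists_injective_prod_nat`), the tuple (image, group law, open sets, `Πⱼ → G`, `Π̃ⱼ`,
`ρⱼ`) read in `W`.  [cite: MochizukiAbsTopI2012, Def 4.2 (iv) p.50] -/
theorem ChainGroup.exists_code :
    ∃ code : E.ChainGroup →
        Set (E.arith × ℕ) × ((E.arith × ℕ) → (E.arith × ℕ) → (E.arith × ℕ)) ×
          Set (Set (E.arith × ℕ)) × ((E.arith × ℕ) → E.gal) × Subgroup E.arith ×
            (E.arith → E.arith × ℕ),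
      ∀ L₁ L₂ : E.ChainGroup, code L₁ = code L₂ →
        Nonempty (ChainGroupIsoOver (Iso.refl E) L₁ L₂) := by
  classical
  have hinj : ∀ L : E.ChainGroup, ∃ f : L.grp → E.arith × ℕ, Function.Injective f :=
    ChainGroup.exists_injective_prod_nat
  choose ι hι using hinj
  -- a left inverse of each `ι L`
  let σ : ∀ L : E.ChainGroup, E.arith × ℕ → L.grp := fun L => Function.invFun (ι L)
  have hσ : ∀ (L : E.ChainGroup) (a : L.grp), σ L (ι L a) = a := fun L =>
    Function.leftInverse_invFun (hι L)
  refine ⟨fun L =>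
    (Set.range (ι L),
      fun w w' => ι L (σ L w * σ L w'),
      {U | ∃ V : Set L.grp, IsOpen V ∧ U = ι L '' V},
      fun w => L.proj (σ L w),
      L.dom,
      fun x => if h : x ∈ L.dom then ι L (L.rig ⟨x, h⟩) else (1, 0)), ?_⟩
  intro L₁ L₂ h
  simp only [Prod.mk.injEq] at h
  obtain ⟨hs, hm, hO, hp, hd, hr⟩ := h
  refine ChainGroup.nonempty_isoOver_refl_of_matched (ι L₁) (ι L₂) (hι L₁) (hι L₂) hs ?_ ?_ ?_ hd ?_
  · intro a b a' b' ha hb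
    have key := congrFun (congrFun hm (ι L₁ a)) (ι L₁ b)
    rw [hσ, hσ, ha, hb, hσ, hσ] at key
    exact key
  · intro U
    exact Set.ext_iff.mp hO U
  · intro a a' ha
    have key := congrFun hp (ι L₁ a)
    rwa [hσ, ha, hσ] at key
  · intro x hx₁ hx₂
    have key := congrFun hr x
    rwa [dif_pos hx₁, dif_pos hx₂] at key

/-! ### `Chain(Π)` is essentially small -/

/-- **`Chain(Π)` is essentially `u`-small** ([AbsTopI] Def 4.2 (iii)/(iv)): over every extension
`1 → Δ → Π → G → 1` with cuspidal data and slimness inputs there are an index type `ι : Type u` and a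
family of `Π`-chains `g : ι → Chain(Π)` such that EVERY `Π`-chain is isomorphic (identical type-chain,
termwise isomorphisms over `id` compatible with the rigidifying homomorphisms) to some `g i` — although
the type of `Π`-chains itself lives in `Type (u+1)`.  Proof: code a chain by its length, its type-chain
and the codes of its terms (`ChainGroup.exists_code`), and choose one chain per realised code.
[cite: MochizukiAbsTopI2012, Def 4.2 (iv) p.50] -/
theorem PiChain.exists_small_cover (C : CuspidalData E) (hP : IsSlimGroup E.arith)
    (hΔ : IsSlimGroup E.geom) (hne : E.geom ≠ ⊥) :
    ∃ (ι : Type u) (g : ι → E.PiChain C hP hΔ hne),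
      ∀ c : E.PiChain C hP hΔ hne, ∃ i, PiChainIsoOver (Iso.refl E) (g i) c := by
  classical
  obtain ⟨code, hcode⟩ := ChainGroup.exists_code (E := E)
  -- the code of a chain: length, type-chain, codes of the terms (indexed by `ℕ` to avoid casts)
  let ccode : E.PiChain C hP hΔ hne →
      ℕ × (ℕ → Option ElemOpType) × (ℕ → Option (Set (E.arith × ℕ) ×
        ((E.arith × ℕ) → (E.arith × ℕ) → (E.arith × ℕ)) × Set (Set (E.arith × ℕ)) ×
          ((E.arith × ℕ) → E.gal) × Subgroup E.arith × (E.arith → E.arith × ℕ))) :=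
    fun c => (c.len, fun m => if h : m < c.len then some (c.types ⟨m, h⟩) else none,
      fun m => if h : m < c.len + 1 then some (code (c.term ⟨m, h⟩)) else none)
  -- equal codes ⇒ isomorphic chains
  have key : ∀ c' c : E.PiChain C hP hΔ hne, ccode c' = ccode c →
      PiChainIsoOver (Iso.refl E) c' c := by
    intro c' c h
    simp only [ccode, Prod.mk.injEq] at h
    obtain ⟨hlen, htypes, hterms⟩ := h
    refine ⟨hlen, fun j₁ j₂ hj => ?_, fun j₁ j₂ hj => ?_⟩
    · have h₂ : j₁.val < c.len := hj ▸ j₂.2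
      have e := congrFun htypes j₁.val
      simp only [dif_pos j₁.2, dif_pos h₂, Option.some.injEq] at e
      rw [e]
      exact congrArg c.types (Fin.ext hj)
    · have h₂ : j₁.val < c.len + 1 := hj ▸ j₂.2
      have e := congrFun hterms j₁.val
      simp only [dif_pos j₁.2, dif_pos h₂, Option.some.injEq] at e
      have hj₂ : (⟨j₁.val, h₂⟩ : Fin (c.len + 1)) = j₂ := Fin.ext hj
      rw [← hj₂]
      exact hcode _ _ e
  refine ⟨Set.range ccode, fun k => Classical.choose (Set.mem_range.mp k.2), fun c => ?_⟩
  refine ⟨⟨ccode c, Set.mem_range_self c⟩, key _ _ ?_⟩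
  exact Classical.choose_spec (Set.mem_range.mp (Set.mem_range_self (f := ccode) c))

/-! ### Thm 4.7 (i) ∧ (iii) model-witnessed at every parameter -/

/-- **[AbsTopI] Thm 4.7 (i) and (iii)** p. 57, as typed (`SchemeChains.Thm_4_7_i`,
`SchemeChains.Thm_4_7_iii`, shape (M) over the scheme-chain interface of Rmk 4.2.1 p. 51): at EVERY
admissible parameter `(E, C, hP, hΔ, hne)` there is a scheme-chain datum `S` satisfying BOTH — the
small skeleton `g : ι → Chain(Π)` of `PiChain.exists_small_cover` as objects ("the natural functor
`Chain(X̃/X) → Chain(Π)`" := `g`, essentially surjective by construction), with the isomorphisms,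
terminal morphisms and terminal isomorphisms of `Chain(Π)` / `Chain^{trm}(Π)` / `Chain^{iso-trm}(Π)`
pulled back along `g` (so the functor is full on them by definition).  HONEST LABEL: the scheme side
`Chain(X̃/X)` (Def 4.2 (i)(ii)) is MODELLED here by the group-theoretic side; this is a consistency /
joint-satisfiability witness for the typed predicates (FACT-LIST F-0200, F-0202), not the theorem for
a hyperbolic orbicurve, whose scheme side is not in the tree (FOUNDATIONS row 12).
[cite: MochizukiAbsTopI2012, Thm 4.7 (i) p.57] -/
theorem SchemeChains.exists_thm_4_7_i_and_iii (C : CuspidalData E) (hP : IsSlimGroup E.arith)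
    (hΔ : IsSlimGroup E.geom) (hne : E.geom ≠ ⊥) :
    ∃ S : SchemeChains E C hP hΔ hne, S.Thm_4_7_i ∧ S.Thm_4_7_iii := by
  obtain ⟨ι, g, hg⟩ := PiChain.exists_small_cover C hP hΔ hne
  refine ⟨{ Obj := ι
            toPiChain := g
            ChainIso := fun x y => PiChainIsoOver (Iso.refl E) (g x) (g y)
            HasTerminalMor := fun x y => (g x).HasTerminalHom (g y)
            HasTerminalIso := fun x y => (g x).HasTerminalIso (g y)
            map_iso := fun _ _ h => h
            map_terminalMor := fun _ _ h => h
            map_terminalIso := fun _ _ h => h }, ?_, ?_⟩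
  · exact ⟨hg, fun _ _ h => h, fun _ _ h => h⟩
  · exact fun _ _ h => h

/-- The two rows separately, for citation by F-id: **F-0200** `SchemeChains.Thm_4_7_i` is
model-witnessed at every parameter. [cite: MochizukiAbsTopI2012, Thm 4.7 (i) p.57] -/
theorem SchemeChains.exists_thm_4_7_i (C : CuspidalData E) (hP : IsSlimGroup E.arith)
    (hΔ : IsSlimGroup E.geom) (hne : E.geom ≠ ⊥) :
    ∃ S : SchemeChains E C hP hΔ hne, S.Thm_4_7_i :=
  let ⟨S, h, _⟩ := SchemeChains.exists_thm_4_7_i_and_iii C hP hΔ hne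
  ⟨S, h⟩

/-- **F-0202** `SchemeChains.Thm_4_7_iii` model-witnessed by a datum whose functor to `Chain(Π)` is
moreover ESSENTIALLY SURJECTIVE (every `Π`-chain — in particular the trivial chain `Π₀ = Π` — is hit up
to isomorphism), i.e. not by the degenerate one-object datum of `SemiAbsoluteChainsSchema.lean`.
[cite: MochizukiAbsTopI2012, Thm 4.7 (iii) p.57] -/
theorem SchemeChains.exists_thm_4_7_iii_and_essSurj (C : CuspidalData E) (hP : IsSlimGroup E.arith)
    (hΔ : IsSlimGroup E.geom) (hne : E.geom ≠ ⊥) :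
    ∃ S : SchemeChains E C hP hΔ hne, S.Thm_4_7_iii ∧
      ∀ c : E.PiChain C hP hΔ hne, ∃ x : S.Obj, PiChainIsoOver (Iso.refl E) (S.toPiChain x) c :=
  let ⟨S, h, h'⟩ := SchemeChains.exists_thm_4_7_i_and_iii C hP hΔ hne
  ⟨S, h', h.1⟩

/-- Hence ALL FOUR typed clauses of **[AbsTopI] Thm 4.7** p. 57 hold JOINTLY at one scheme-chain
datum over every admissible parameter: (i) ∧ (iii) for the witness `S` of this file, together with the
closed clauses (ii) (`thm_4_7_ii_holds`, `ChainTransportThm.lean`) and (iv) (`thm_4_7_iv_holds`,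
`SemiAbsoluteChainsProofs.lean`), which are PROVED outright for the `Π`-chains of `AbsTopIChains.lean`.
Same honest label as above for (i)/(iii). [cite: MochizukiAbsTopI2012, Thm 4.7 p.57] -/
theorem SchemeChains.exists_thm_4_7_i_ii_iii_iv (C : CuspidalData E) (hP : IsSlimGroup E.arith)
    (hΔ : IsSlimGroup E.geom) (hne : E.geom ≠ ⊥) :
    ∃ S : SchemeChains E C hP hΔ hne,
      S.Thm_4_7_i ∧ Thm_4_7_ii.{u} ∧ S.Thm_4_7_iii ∧ Thm_4_7_iv.{u} :=
  let ⟨S, h, h'⟩ := SchemeChains.exists_thm_4_7_i_and_iii C hP hΔ hne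
  ⟨S, h, thm_4_7_ii_holds, h', thm_4_7_iv_holds⟩

/-! ### Appended (same seat): the `𝒟`-hypothesised forms are model-witnessed too

With `SchemeChains.exists_thm_4_7_i_and_iii` the four CLASS-LEVEL named facts of
`SemiAbsoluteChainsHyp.lean` — `Thm_4_7_i_of` / `Thm_4_7_iii_of` (FACT-LIST F-0204 / F-0205, class `𝒟`
free) and the linked `Thm_4_7_i_ofMem` / `Thm_4_7_iii_ofMem` (F-2661 / F-2662, data of a member of
`𝒟`) — hold at SOME scheme-chain datum over EVERY class, member and parameter (their conclusions
`S.Thm_4_7_i ∧ S.Thm_4_7_iii` hold outright at the small-skeleton witness).  Their universal closures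
over `S` were refuted in `SemiAbsoluteChainsHypSchemaNegative.lean` (abc-iut-f-059); same honest label as
above: the scheme side is modelled by the group-theoretic side. -/

/-- **F-0204 / F-0205 model-witnessed**: for every class `𝒟` and every parameter there is a
scheme-chain datum `S` with `Thm_4_7_i_of 𝒟 S ∧ Thm_4_7_iii_of 𝒟 S` (the class-level hypotheses are
not even used: the conclusions hold at the witness). [cite: MochizukiAbsTopI2012, Thm 4.7 (i) p.57] -/
theorem SchemeChains.exists_thm_4_7_i_of_and_iii_of (𝒟 : ConstructionDataClass.{u})
    (C : CuspidalData E) (hP : IsSlimGroup E.arith) (hΔ : IsSlimGroup E.geom) (hne : E.geom ≠ ⊥) :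
    ∃ S : SchemeChains E C hP hΔ hne, Thm_4_7_i_of 𝒟 S ∧ Thm_4_7_iii_of 𝒟 S :=
  let ⟨S, h, h'⟩ := SchemeChains.exists_thm_4_7_i_and_iii C hP hΔ hne
  ⟨S, fun _ _ => h, fun _ _ => ⟨h, h'⟩⟩

/-- **F-2661 / F-2662 model-witnessed**: for every class `𝒟`, every member `X` over `k_b` and every
parameter over ITS extension `(𝒟.datum b).ext X` there is a scheme-chain datum `S` with
`Thm_4_7_i_ofMem 𝒟 b X S ∧ Thm_4_7_iii_ofMem 𝒟 b X S`. [cite: MochizukiAbsTopI2012, Thm 4.7 (iii) p.57] -/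
theorem SchemeChains.exists_thm_4_7_i_ofMem_and_iii_ofMem (𝒟 : ConstructionDataClass.{u})
    (b : 𝒟.Base) (X : (𝒟.datum b).Obj) (C : CuspidalData ((𝒟.datum b).ext X))
    (hP : IsSlimGroup ((𝒟.datum b).ext X).arith) (hΔ : IsSlimGroup ((𝒟.datum b).ext X).geom)
    (hne : ((𝒟.datum b).ext X).geom ≠ ⊥) :
    ∃ S : SchemeChains ((𝒟.datum b).ext X) C hP hΔ hne,
      Thm_4_7_i_ofMem 𝒟 b X S ∧ Thm_4_7_iii_ofMem 𝒟 b X S :=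
  let ⟨S, h, h'⟩ := SchemeChains.exists_thm_4_7_i_and_iii C hP hΔ hne
  ⟨S, fun _ _ _ => h, fun _ _ _ _ => ⟨h, h'⟩⟩

end Literature.AnabelianGeometry.AbsoluteAnabelian.AbsTopI
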